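import Summits.CriticalPhenomena.Ising3DConformalLimit.Theses.GaussianScaleMixture

/-!
# `stub_latticeSymmetryTransport` of line `two-crystals-generate-so3` (crux `RotationUpgradeFromTwoPoint`,
stmt-CriticalPhenomena-8367) — kernel-checked verification by the deep-refute seat

Statement copied VERBATIM from `Cruxes/RotationUpgradeFromTwoPoint/Lines/two-crystals-generate-so3.lean`
(gen 2). Proof: the EXACT rounding identity
`rescaledCorrelator G ρ n δ (M ∘ x) = rescaledCorrelator G ρ n δ (x + δ • N r(δ,x))` with the integer
defect `r = ⌊M y⌋ − M ⌊y⌋` (bounded: `|r_j| ≤ Σ_k |M_jk| + 1`), then locally uniform convergence on the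
open set `NonCoincident` at `x` + continuity of `S n` at `x`, and uniqueness of limits along `𝓝[>] 0`.
Candidate proof for the worker holding the stub (refuters do not land positive statements).
-/

noncomputable section

open Literature.Probability.LatticeModels Set Filter Matrix
open scoped Topology

namespace Summit.CriticalPhenomena.Ising3DConformalLimit.Cruxes.RotationUpgradeFromTwoPoint.DrefuteTwoCrystals

variable {d : ℕ}

/-! ### The real action of an integer matrix -/

/-- Coordinates of the real action of an integer matrix. [folklore] -/
theorem toEuclideanLin_intCast_apply (M : Matrix (Fin d) (Fin d) ℤ) (v : EuclideanSpace ℝ (Fin d))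
    (j : Fin d) :
    Matrix.toEuclideanLin (M.map ((↑) : ℤ → ℝ)) v j = ∑ k, (M j k : ℝ) * v k := by
  simp [Matrix.toEuclideanLin, Matrix.toLpLin_apply, Matrix.mulVec, dotProduct]

/-- The real action in `mulVec` form. [folklore] -/
theorem ofLp_toEuclideanLin_intCast (M : Matrix (Fin d) (Fin d) ℤ) (v : EuclideanSpace ℝ (Fin d)) :
    WithLp.ofLp (Matrix.toEuclideanLin (M.map ((↑) : ℤ → ℝ)) v) =
      (M.map ((↑) : ℤ → ℝ)) *ᵥ WithLp.ofLp v := by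
  funext j
  rw [show WithLp.ofLp (Matrix.toEuclideanLin (M.map ((↑) : ℤ → ℝ)) v) j =
      Matrix.toEuclideanLin (M.map ((↑) : ℤ → ℝ)) v j from rfl, toEuclideanLin_intCast_apply]
  simp [Matrix.mulVec, dotProduct]

/-- A two-sided integer inverse gives a left inverse of the real action. [folklore] -/
theorem toEuclideanLin_leftInverse (M N : Matrix (Fin d) (Fin d) ℤ) (hNM : N * M = 1)
    (v : EuclideanSpace ℝ (Fin d)) :
    Matrix.toEuclideanLin (N.map ((↑) : ℤ → ℝ)) (Matrix.toEuclideanLin (M.map ((↑) : ℤ → ℝ)) v) = v := by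
  have hmap : N.map ((↑) : ℤ → ℝ) * M.map ((↑) : ℤ → ℝ) = 1 := by
    have h := congrArg (fun A : Matrix (Fin d) (Fin d) ℤ => A.map (Int.castRingHom ℝ)) hNM
    simp only [Matrix.map_mul] at h
    rw [Matrix.map_one _ (by simp) (by simp)] at h
    exact h
  have key : WithLp.ofLp (Matrix.toEuclideanLin (N.map ((↑) : ℤ → ℝ))
      (Matrix.toEuclideanLin (M.map ((↑) : ℤ → ℝ)) v)) = WithLp.ofLp v := by
    rw [ofLp_toEuclideanLin_intCast, ofLp_toEuclideanLin_intCast, Matrix.mulVec_mulVec, hmap,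
      Matrix.one_mulVec]
  exact (WithLp.ofLp_injective 2) key

/-! ### The rounding defect -/

/-- The integer rounding defect `r = ⌊M y/δ⌋ − M ⌊y/δ⌋`. [folklore] -/
def rdef (M : Matrix (Fin d) (Fin d) ℤ) (δ : ℝ) (y : EuclideanSpace ℝ (Fin d)) : Fin d → ℤ :=
  latticeApprox δ (Matrix.toEuclideanLin (M.map ((↑) : ℤ → ℝ)) y) - M *ᵥ latticeApprox δ y

/-- The defect identity `⌊M y/δ⌋ = M(⌊y/δ⌋ + N r)`. [folklore] -/
theorem latticeApprox_toEuclideanLin (M N : Matrix (Fin d) (Fin d) ℤ) (hMN : M * N = 1) (δ : ℝ)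
    (y : EuclideanSpace ℝ (Fin d)) :
    latticeApprox δ (Matrix.toEuclideanLin (M.map ((↑) : ℤ → ℝ)) y) =
      M *ᵥ (latticeApprox δ y + N *ᵥ rdef M δ y) := by
  rw [Matrix.mulVec_add, Matrix.mulVec_mulVec, hMN, Matrix.one_mulVec, rdef, add_sub_cancel]

/-- Shifting by `δ` times an integer vector shifts the lattice approximation. [folklore] -/
theorem latticeApprox_add_smul_intCast {δ : ℝ} (hδ : δ ≠ 0) (y : EuclideanSpace ℝ (Fin d))
    (m : Fin d → ℤ) :
    latticeApprox δ (y + δ • WithLp.toLp 2 (fun j => (m j : ℝ))) = latticeApprox δ y + m := by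
  funext j
  rw [Pi.add_apply, latticeApprox_apply, latticeApprox_apply, PiLp.add_apply, PiLp.smul_apply,
    PiLp.toLp_apply, smul_eq_mul, add_div, mul_div_cancel_left₀ _ hδ, Int.floor_add_intCast]

/-- The defect is a floor of a bounded sum: `r_j = ⌊Σ_k M_jk · fract(y_k/δ)⌋`. [folklore] -/
theorem rdef_eq_floor (M : Matrix (Fin d) (Fin d) ℤ) (δ : ℝ) (y : EuclideanSpace ℝ (Fin d))
    (j : Fin d) :
    rdef M δ y j = ⌊∑ k, (M j k : ℝ) * Int.fract (y k / δ)⌋ := by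
  rw [rdef, Pi.sub_apply, latticeApprox_apply, toEuclideanLin_intCast_apply, Finset.sum_div]
  have hsplit : ∑ k, (M j k : ℝ) * y k / δ =
      ((M *ᵥ latticeApprox δ y) j : ℝ) + ∑ k, (M j k : ℝ) * Int.fract (y k / δ) := by
    simp only [Matrix.mulVec, dotProduct, latticeApprox_apply, Int.cast_sum, Int.cast_mul,
      ← Finset.sum_add_distrib]
    refine Finset.sum_congr rfl fun k _ => ?_
    rw [mul_div_assoc, ← Int.floor_add_fract (y k / δ)]
    simp only [Int.floor_add_fract]
    rw [← Int.floor_add_fract (y k / δ)]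
    ring_nf
    simp
  rw [hsplit, Int.floor_intCast_add]
  ring

/-- Uniform bound on the defect: `|r_j| ≤ Σ_k |M_jk| + 1`. [folklore] -/
theorem abs_rdef_le (M : Matrix (Fin d) (Fin d) ℤ) (δ : ℝ) (y : EuclideanSpace ℝ (Fin d))
    (j : Fin d) :
    |(rdef M δ y j : ℝ)| ≤ (∑ k, |(M j k : ℝ)|) + 1 := by
  rw [rdef_eq_floor]
  set s : ℝ := ∑ k, (M j k : ℝ) * Int.fract (y k / δ) with hs
  have hsb : |s| ≤ ∑ k, |(M j k : ℝ)| := by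
    refine (Finset.abs_sum_le_sum_abs _ _).trans (Finset.sum_le_sum fun k _ => ?_)
    rw [abs_mul, abs_of_nonneg (Int.fract_nonneg (y k / δ))]
    exact mul_le_of_le_one_right (abs_nonneg _) (Int.fract_lt_one _).le
  have h1 : (⌊s⌋ : ℝ) ≤ s := Int.floor_le s
  have h2 : s < (⌊s⌋ : ℝ) + 1 := Int.lt_floor_add_one s
  rw [abs_le] at hsb ⊢
  constructor <;> linarith [hsb.1, hsb.2]

/-! ### The theorem -/

/-- **`stub_latticeSymmetryTransport`** (verbatim). [folklore] -/
theorem latticeSymmetryTransport_holds :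
  ∀ (d : ℕ) (G : LatticeCorrFamily d) (ρ : ℝ → ℝ) (S : CorrFamily d)
    (M N : Matrix (Fin d) (Fin d) ℤ), M * N = 1 → N * M = 1 →
    (∀ (n : ℕ) (k : Fin n → Site d), G n (fun i => M.mulVec (k i)) = G n k) →
    HasPointwiseScalingLimit G ρ S →
    (∀ n, ContinuousOn (S n) (NonCoincident d n)) →
    ∀ (n : ℕ) (x : Fin n → EuclideanSpace ℝ (Fin d)), x ∈ NonCoincident d n →
      S n (fun i => Matrix.toEuclideanLin (M.map ((↑) : ℤ → ℝ)) (x i)) = S n x := by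
  intro d G ρ S M N hMN hNM hG hlim hcont n x hx
  set L := Matrix.toEuclideanLin (M.map ((↑) : ℤ → ℝ)) with hL
  -- `M x` is non-coincident
  have hLinj : Function.Injective L :=
    Function.LeftInverse.injective (g := Matrix.toEuclideanLin (N.map ((↑) : ℤ → ℝ)))
      (toEuclideanLin_leftInverse M N hNM)
  have hMx : (fun i => L (x i)) ∈ NonCoincident d n := by
    rw [mem_nonCoincident] at hx ⊢
    exact hLinj.comp hx
  -- the shifted configurations
  set z : ℝ → Fin n → EuclideanSpace ℝ (Fin d) :=
    fun δ i => WithLp.toLp 2 (fun j => ((N *ᵥ rdef M δ (x i)) j : ℝ)) with hz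
  set y : ℝ → Fin n → EuclideanSpace ℝ (Fin d) := fun δ i => x i + δ • z δ i with hy
  -- EXACT identity of rescaled correlators
  have hresc : ∀ δ : ℝ, 0 < δ →
      rescaledCorrelator G ρ n δ (fun i => L (x i)) = rescaledCorrelator G ρ n δ (y δ) := by
    intro δ hδ
    rw [rescaledCorrelator_apply, rescaledCorrelator_apply]
    congr 1
    have h1 : (fun i => latticeApprox δ (L (x i))) =
        fun i => M *ᵥ (latticeApprox δ (x i) + N *ᵥ rdef M δ (x i)) := by
      funext i; exact latticeApprox_toEuclideanLin M N hMN δ (x i)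
    have h2 : (fun i => latticeApprox δ (y δ i)) =
        fun i => latticeApprox δ (x i) + N *ᵥ rdef M δ (x i) := by
      funext i; exact latticeApprox_add_smul_intCast hδ.ne' (x i) _
    rw [h1, hG, h2]
  -- the shifts are `O(δ)`: `y δ → x` as `δ → 0⁺`
  have hbound : ∀ (δ : ℝ) (i : Fin n) (j : Fin d),
      |z δ i j| ≤ (∑ k, |(N j k : ℝ)|) * ((∑ j', ∑ k, |(M j' k : ℝ)|) + 1) := by
    intro δ i j
    have hz' : z δ i j = ∑ k, (N j k : ℝ) * (rdef M δ (x i) k : ℝ) := by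
      simp [hz, Matrix.mulVec, dotProduct]
    rw [hz', Finset.sum_mul]
    refine (Finset.abs_sum_le_sum_abs _ _).trans (Finset.sum_le_sum fun k _ => ?_)
    rw [abs_mul]
    refine mul_le_mul_of_nonneg_left ?_ (abs_nonneg _)
    refine (abs_rdef_le M δ (x i) k).trans ?_
    have : ∑ k', |(M k k' : ℝ)| ≤ ∑ j', ∑ k', |(M j' k' : ℝ)| :=
      Finset.single_le_sum (f := fun j' => ∑ k', |(M j' k' : ℝ)|)
        (fun j' _ => Finset.sum_nonneg fun k' _ => abs_nonneg _) (Finset.mem_univ k)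
    linarith
  have hyx : Tendsto y (𝓝[>] (0:ℝ)) (𝓝 x) := by
    rw [tendsto_pi_nhds]
    intro i
    have hcoord : Tendsto (fun δ => WithLp.ofLp (y δ i)) (𝓝[>] (0:ℝ)) (𝓝 (WithLp.ofLp (x i))) := by
      rw [tendsto_pi_nhds]
      intro j
      have hform : ∀ δ, WithLp.ofLp (y δ i) j = x i j + δ * z δ i j := by
        intro δ; simp [hy]
      simp only [hform]
      have h0 : Tendsto (fun δ : ℝ => δ * z δ i j) (𝓝[>] (0:ℝ)) (𝓝 0) := by
        set B := (∑ k, |(N j k : ℝ)|) * ((∑ j', ∑ k, |(M j' k : ℝ)|) + 1) with hB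
        have hδ0 : Tendsto (fun δ : ℝ => B * |δ|) (𝓝[>] (0:ℝ)) (𝓝 0) := by
          have : Tendsto (fun δ : ℝ => B * |δ|) (𝓝 (0:ℝ)) (𝓝 (B * |0|)) :=
            (continuous_const.mul continuous_abs).tendsto 0
          rw [abs_zero, mul_zero] at this
          exact this.mono_left nhdsWithin_le_nhds
        refine squeeze_zero_norm (fun δ => ?_) hδ0
        rw [Real.norm_eq_abs, abs_mul, mul_comm]
        exact mul_le_mul_of_nonneg_right (hbound δ i j) (abs_nonneg _)
      simpa using (tendsto_const_nhds (x := x i j)).add h0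
    have hcts : Continuous (fun v : Fin d → ℝ => WithLp.toLp 2 v) := PiLp.continuous_toLp 2 _
    have h := (hcts.tendsto (WithLp.ofLp (x i))).comp hcoord
    simp only [Function.comp_def, WithLp.toLp_ofLp] at h
    exact h
  have hopen : NonCoincident d n ∈ 𝓝 x := (isOpen_nonCoincident d n).mem_nhds hx
  have hyNC : Tendsto y (𝓝[>] (0:ℝ)) (𝓝[NonCoincident d n] x) :=
    tendsto_nhdsWithin_iff.2 ⟨hyx, hyx.eventually_mem hopen⟩
  -- limit along the shifted configurations is `S n x`
  have hB : Tendsto (fun δ => rescaledCorrelator G ρ n δ (y δ)) (𝓝[>] (0:ℝ)) (𝓝 (S n x)) := by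
    rw [Metric.tendsto_nhds]
    intro ε hε
    obtain ⟨t, ht, hev⟩ :=
      (Metric.tendstoLocallyUniformlyOn_iff.1 (hlim n)) (ε / 2) (half_pos hε) x hx
    obtain ⟨u, hu, hut⟩ := mem_nhdsWithin_iff_exists_mem_nhds_inter.1 ht
    have ht' : t ∈ 𝓝 x := Filter.mem_of_superset (Filter.inter_mem hu hopen) hut
    have hyt : ∀ᶠ δ in 𝓝[>] (0:ℝ), y δ ∈ t := hyx.eventually_mem ht'
    have hSy : ∀ᶠ δ in 𝓝[>] (0:ℝ), dist (S n (y δ)) (S n x) < ε / 2 :=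
      Metric.tendsto_nhds.1 ((hcont n x hx).tendsto.comp hyNC) (ε / 2) (half_pos hε)
    filter_upwards [hev, hyt, hSy] with δ h1 h2 h3
    calc dist (rescaledCorrelator G ρ n δ (y δ)) (S n x)
        ≤ dist (rescaledCorrelator G ρ n δ (y δ)) (S n (y δ)) + dist (S n (y δ)) (S n x) :=
          dist_triangle _ _ _
      _ < ε / 2 + ε / 2 := by
          refine add_lt_add ?_ h3
          rw [dist_comm]; exact h1 _ h2
      _ = ε := by ring
  -- limit along `M x` is `S n (M x)`; the two sequences coincide
  have hA : Tendsto (fun δ => rescaledCorrelator G ρ n δ (fun i => L (x i))) (𝓝[>] (0:ℝ))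
      (𝓝 (S n (fun i => L (x i)))) := (hlim n).tendsto_at hMx
  have hA' : Tendsto (fun δ => rescaledCorrelator G ρ n δ (fun i => L (x i))) (𝓝[>] (0:ℝ))
      (𝓝 (S n x)) :=
    hB.congr' (eventually_nhdsWithin_of_forall fun δ hδ => (hresc δ hδ).symm)
  exact tendsto_nhds_unique hA hA'

end Summit.CriticalPhenomena.Ising3DConformalLimit.Cruxes.RotationUpgradeFromTwoPoint.DrefuteTwoCrystals

end
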